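import Literature.MathematicalPhysics.QuantumManyBody.LiebSimpleEquationFacts
import HarnessLib

/-!
# Lieb's simple equation: the pinned system for `μ < 0`, and why the tree's `η` vanishes

Topic: `Literature/MathematicalPhysics/QuantumManyBody`. Proved statements about the pinned
("`μ`-modified") simple equation of Carlen–Jauslin–Lieb II (CJL-II = SIAM J. Math. Anal. 53 (2021),
arXiv:2010.13882, (1.20)–(1.21)) as rendered in `LiebSimpleEquation.lean` (`IsPinnedSolution`,
`pinnedEnergy`, `eta`), written while auditing the tree's first rendering of CJL-II Theorem 6 (then
the named fact `CarlenJauslinLieb2021_thm6` of `LiebSimpleEquationFacts.lean`, retired from that file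
in the verdict clean-up of 2026-08-15). Outcome of the audit: **that rendering is wrong** — its `η`
is the tree's `eta`, a two-sided `μ`-derivative, which is identically `0`.

## Contents (all proved)

* `IsPinnedSolution.mass_identity` — integrating the mild form of (1.20) with kernel mass
  `c = 4e + 2μ > 0`: `c∫u = 2e/ρ + 2eρ(∫u)²` (the computation CJL-I (1.11), using the tree's
  `integral_yukawa`, `integral_conv_self`).
* `IsPinnedSolution.mu_nonneg` — hence **no pinned solution exists for `μ < 0`** (`ρ, e > 0`,
  `4e + 2μ > 0`): `2eρX² − cX + 2e/ρ = 0` has discriminant `4μ(4e + μ) < 0`. CJL-II §5 leave the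
  existence theory of (1.20) "to the reader"; this shows their `η = ∂_μ e_μ|_{μ=0}` can only be a
  right derivative. `IsPinnedSolution.energy_le_of_neg`, `pinnedEnergy_le_of_neg`:
  `0 ≤ e_μ ≤ −μ/2` for `μ < 0` (the tree's `pinnedEnergy` is an `sInf` with junk value `0`).
* `eta_eq_zero` — **`eta 𝒱 ρ = 0` for every integrable `𝒱` and `ρ > 0`**: a function squeezed
  in `[0, −μ/2]` on `μ < 0` has two-sided derivative `0` at `0` if it has one at all (and Mathlib's
  `deriv` is `0` otherwise).
* `IsScatteringSolution.scatteringLengthOf_pos` — a scattering solution of a potential `v ≥ 0`,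
  `∫v > 0`, has `a = (4π)⁻¹∫v(1 − φ) > 0` (including the bookkeeping for a non-measurable `φ`,
  `aestronglyMeasurable_of_yukawa_integrand`).
* `not_CarlenJauslinLieb2021_thm6_of_thm1` — **`CarlenJauslinLieb2020_thm1` refutes the first
  rendering of CJL-II Theorem 6** (spelled out in the type; formerly the named fact
  `CarlenJauslinLieb2021_thm6`): with `η ≡ 0`, the clause `|η − X| ≤ εX`, `X > 0`, fails at the
  small-density solution triples that CJL-I Theorem 1 provides (test potential `v = 1_{B₁}`,
  `isWeightedPotential_indicator_closedBall`). So the two vendored facts are jointly inconsistent;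
  the defect is in the rendering of Theorem 6 (the definition `eta`), not in either paper.

## The corrected reading (recorded, not vendored here)

CJL-II Theorem 6 concerns `η := ∂_μ e_μ|_{μ=0⁺}` along a branch `μ ↦ (e_μ, u_μ)`, `μ ≥ 0`, of
solutions of (1.20) at fixed density `ρ` through `(e, u)`; what §5 proves is (a) along any such
differentiable branch the derivative is `etaFormula 𝒱 ρ e u` (the right side of (1.25)), and
(b) `etaFormula ∼ 8√(ρa₀³)/(3√π)` as `ρ → 0` over solution triples. A faithful named fact should
state (a) with a right derivative (`HasDerivWithinAt … (Set.Ici 0) 0`) and (b) for `etaFormula`.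
(Verdict clean-up of 2026-08-15: this reading — with the `L²(ℝ³)`-differentiability of the branch
at `0⁺` as the hypothesis of (a) — is recorded as an elaborated Lean statement in the module
docstring of the facts file, §"CJL-II Theorem 6: the corrected rendering", to be vendored as the
named fact `CarlenJauslinLieb2021_thm6_rightDeriv` by a definition or cite seat; the first
rendering, refuted, is retired from the facts file (REFUTED ⇒ retire, as CJL-II Theorems 2 and 3
before it), which is why `not_CarlenJauslinLieb2021_thm6_of_thm1` below spells its statement out
instead of naming it.)

## References

* [CarlenJauslinLieb2021] E. A. Carlen, I. Jauslin, E. H. Lieb, *Analysis of a simple equation for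
  the ground state of the Bose gas II: monotonicity, convexity, and condensate fraction*, SIAM J.
  Math. Anal. 53 (2021) 5322–5360, arXiv:2010.13882: (1.20)–(1.21), Theorem 6, §5 (p. 14 of the
  arXiv version: existence/differentiability for (1.20) "left to the reader").
* [CarlenJauslinLieb2020] E. A. Carlen, I. Jauslin, E. H. Lieb, *Analysis of a simple equation for
  the ground state energy of the Bose gas*, Pure Appl. Anal. 2 (2020) 659–684, arXiv:1912.04987:
  (1.10)–(1.11), Theorem 1, Lemma 3.1 (3.11).
-/

noncomputable section

open MeasureTheory Filter Set
open scoped ENNReal Topology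

namespace Literature.MathematicalPhysics.QuantumManyBody

namespace LiebSimpleEquation

open BoseGas (Space)

/-! ## Integrating the pinned system: no solutions for `μ < 0` -/

/-- For a pinned solution `u` (`0 ≤ u ≤ 1`) and integrable `𝒱`, `(1 − u)𝒱` is integrable.
[cite: CarlenJauslinLieb2021, (1.20)] -/
theorem IsPinnedSolution.integrable_one_sub_mul {𝒱 : Space → ℝ} {ρ μ e : ℝ} {u : Space → ℝ}
    (hu : IsPinnedSolution 𝒱 ρ μ e u) (h1 : Integrable 𝒱) :
    Integrable fun y => (1 - u y) * 𝒱 y := by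
  refine h1.bdd_mul (c := 1) ?_ (Eventually.of_forall fun x => ?_)
  · exact aestronglyMeasurable_const.sub hu.integrable.aestronglyMeasurable
  · have := hu.nonneg x
    have := hu.le_one x
    rw [Real.norm_eq_abs, abs_le]
    constructor <;> linarith

/-- **Mass identity of the pinned system.** Integrating the mild form of CJL-II (1.20) over `ℝ³`
(`∫Y_c = 1/c` for the kernel mass `c = 4e + 2μ > 0`, `∫u∗u = (∫u)²`) and inserting the energy
constraint `∫(1 − u)𝒱 = 2e/ρ` gives `(4e + 2μ)∫u = 2e/ρ + 2eρ(∫u)²` — the computation of CJL-I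
(1.11) for the pinned equation. [cite: CarlenJauslinLieb2021, (1.20)–(1.21)] -/
theorem IsPinnedSolution.mass_identity {𝒱 : Space → ℝ} {ρ μ e : ℝ} {u : Space → ℝ}
    (hu : IsPinnedSolution 𝒱 ρ μ e u) (h1 : Integrable 𝒱) (hρ : ρ ≠ 0)
    (hc : 0 < 4 * e + 2 * μ) :
    (4 * e + 2 * μ) * ∫ x, u x = 2 * e / ρ + 2 * e * ρ * (∫ x, u x) ^ 2 := by
  set F : Space → ℝ := fun y => (1 - u y) * 𝒱 y + 2 * e * ρ * conv u u y with hF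
  have hVu := hu.integrable_one_sub_mul h1
  obtain ⟨huu, hIuu⟩ := integral_conv_self hu.integrable
  have hFint : Integrable F := hVu.add (huu.const_mul (2 * e * ρ))
  have hY : Integrable (yukawa (4 * e + 2 * μ)) := integrable_yukawa hc
  have hIu : ∫ x, u x = 1 / (4 * e + 2 * μ) * ∫ y, F y := by
    rw [integral_congr_ae (Eventually.of_forall hu.mild : (fun x => u x) =ᵐ[volume]
      fun x => conv (yukawa (4 * e + 2 * μ)) F x)]
    change ∫ x, conv (yukawa (4 * e + 2 * μ)) F x = _
    rw [conv, integral_convolution (ContinuousLinearMap.mul ℝ ℝ) hY hFint,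
      ContinuousLinearMap.mul_apply', integral_yukawa hc]
  have hIF : ∫ y, F y = (∫ y, (1 - u y) * 𝒱 y) + 2 * e * ρ * (∫ x, u x) ^ 2 := by
    rw [hF, integral_add hVu (huu.const_mul _), integral_const_mul, hIuu]
  have hE : ∫ y, (1 - u y) * 𝒱 y = 2 * e / ρ := by
    have h := hu.energy
    unfold EnergyConstraint at h
    field_simp
    linarith
  set X := ∫ x, u x with hX
  have hmain : X = 1 / (4 * e + 2 * μ) * (2 * e / ρ + 2 * e * ρ * X ^ 2) := by
    rw [← hE, ← hIF]; exact hIu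
  have hc0 : 4 * e + 2 * μ ≠ 0 := hc.ne'
  calc (4 * e + 2 * μ) * X
        = (4 * e + 2 * μ) * (1 / (4 * e + 2 * μ) * (2 * e / ρ + 2 * e * ρ * X ^ 2)) := by
          rw [← hmain]
    _ = 2 * e / ρ + 2 * e * ρ * X ^ 2 := by
          field_simp

/-- **The pinned system has no solution for `μ < 0`** (in the Yukawa regime `4e + 2μ > 0`): by the
mass identity, `2eρX² − (4e + 2μ)X + 2e/ρ = 0` for `X = ∫u ≥ 0`, whose discriminant
`4μ(4e + μ)` is negative for `−4e < μ < 0`; equivalently `(4e + 2μ)X = 2eρX² + 2e/ρ ≥ 4eX` forces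
`μX ≥ 0`. So a pinned solution with `ρ, e > 0` has `μ ≥ 0`: the `μ`-derivative defining `η` in
CJL-II (1.21) can only be a right derivative. [cite: CarlenJauslinLieb2021, (1.20)–(1.21)] -/
theorem IsPinnedSolution.mu_nonneg {𝒱 : Space → ℝ} {ρ μ e : ℝ} {u : Space → ℝ}
    (hu : IsPinnedSolution 𝒱 ρ μ e u) (h1 : Integrable 𝒱) (hρ : 0 < ρ) (he : 0 < e)
    (hc : 0 < 4 * e + 2 * μ) : 0 ≤ μ := by
  have hid := hu.mass_identity h1 hρ.ne' hc
  set X := ∫ x, u x with hX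
  have hX0 : 0 ≤ X := integral_nonneg hu.nonneg
  by_contra hμ
  push Not at hμ
  have hsq : 4 * e * X ≤ 2 * e / ρ + 2 * e * ρ * X ^ 2 := by
    have h0 : 0 ≤ 2 * e / ρ * (ρ * X - 1) ^ 2 := by positivity
    have hρ0 : ρ ≠ 0 := hρ.ne'
    have : 4 * e * X = 2 * e / ρ + 2 * e * ρ * X ^ 2 - 2 * e / ρ * (ρ * X - 1) ^ 2 := by
      field_simp
      ring
    linarith
  have h4 : 0 ≤ μ * X := by nlinarith
  have h5 : μ * X ≤ 0 := mul_nonpos_of_nonpos_of_nonneg hμ.le hX0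
  have h6 : μ * X = 0 := le_antisymm h5 h4
  rcases mul_eq_zero.mp h6 with h | h
  · exact absurd h hμ.ne
  · rw [h] at hid
    have : 0 < 2 * e / ρ := by positivity
    nlinarith

/-- Energies of pinned solutions at `μ < 0` (`ρ, e > 0`) are at most `−μ/2`: the kernel mass
`4e + 2μ` cannot be positive. [cite: CarlenJauslinLieb2021, (1.20)–(1.21)] -/
theorem IsPinnedSolution.energy_le_of_neg {𝒱 : Space → ℝ} {ρ μ e : ℝ} {u : Space → ℝ}
    (hu : IsPinnedSolution 𝒱 ρ μ e u) (h1 : Integrable 𝒱) (hρ : 0 < ρ) (he : 0 < e)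
    (hμ : μ < 0) : e ≤ -μ / 2 := by
  by_contra h
  push Not at h
  have hc : 0 < 4 * e + 2 * μ := by linarith
  exact absurd (hu.mu_nonneg h1 hρ he hc) (not_le.mpr hμ)

/-! ## The tree's two-sided `eta` vanishes identically -/

/-- `e_μ ≥ 0` (an infimum of positive energies, or the junk value `sInf ∅ = 0`).
[cite: CarlenJauslinLieb2021, (1.20)–(1.21)] -/
theorem pinnedEnergy_nonneg (𝒱 : Space → ℝ) (ρ μ : ℝ) : 0 ≤ pinnedEnergy 𝒱 ρ μ :=
  Real.sInf_nonneg fun _ he => he.1.le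

/-- For `μ < 0` (`ρ > 0`, `𝒱` integrable), `0 ≤ e_μ ≤ −μ/2`: every admissible energy is `≤ −μ/2`
(`IsPinnedSolution.energy_le_of_neg`), and `sInf ∅ = 0`. [cite: CarlenJauslinLieb2021, (1.20)–(1.21)] -/
theorem pinnedEnergy_le_of_neg {𝒱 : Space → ℝ} (h1 : Integrable 𝒱) {ρ μ : ℝ} (hρ : 0 < ρ)
    (hμ : μ < 0) : pinnedEnergy 𝒱 ρ μ ≤ -μ / 2 := by
  unfold pinnedEnergy
  set S : Set ℝ := {e : ℝ | 0 < e ∧ ∃ u, IsPinnedSolution 𝒱 ρ μ e u} with hS_def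
  by_cases hS : S.Nonempty
  · obtain ⟨e, he⟩ := hS
    have he' : e ∈ S := he
    obtain ⟨he0, u, hu⟩ := he
    have hb : BddBelow S := ⟨0, fun e' he' => he'.1.le⟩
    exact (csInf_le hb he').trans (hu.energy_le_of_neg h1 hρ he0 hμ)
  · rw [Set.not_nonempty_iff_eq_empty.mp hS, Real.sInf_empty]
    linarith

/-- **The tree's `η` is identically zero.** `eta 𝒱 ρ = deriv (μ ↦ e_μ) 0` is a two-sided
derivative, but `0 ≤ e_μ ≤ −μ/2` for `μ < 0` (`pinnedEnergy_le_of_neg`: the pinned system CJL-II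
(1.20) has no integrable solution for `μ < 0`). If `μ ↦ e_μ` is differentiable at `0`, continuity
from the left gives `e_0 = 0`, the left difference quotients are `≤ 0` and the right ones `≥ 0`, so
the derivative is `0`; otherwise `deriv` is `0` by convention. Consequently the tree's first
rendering of CJL-II Theorem 6 through `eta` (the theorem has `η ∼ 8√(ρa³)/(3√π) ≠ 0`) is
degenerate; see `not_CarlenJauslinLieb2021_thm6_of_thm1`. [cite: CarlenJauslinLieb2021, (1.21) and Theorem 6] -/
theorem eta_eq_zero {𝒱 : Space → ℝ} (h1 : Integrable 𝒱) {ρ : ℝ} (hρ : 0 < ρ) : eta 𝒱 ρ = 0 := by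
  unfold eta
  set g : ℝ → ℝ := fun μ => pinnedEnergy 𝒱 ρ μ with hg
  by_cases hd : DifferentiableAt ℝ g 0
  · have hs : Tendsto (slope g 0) (𝓝[≠] 0) (𝓝 (deriv g 0)) := hd.hasDerivAt.tendsto_slope
    have hg_nonneg : ∀ μ, 0 ≤ g μ := fun μ => pinnedEnergy_nonneg 𝒱 ρ μ
    have hg0 : g 0 = 0 := by
      have hleft : Tendsto g (𝓝[<] 0) (𝓝 (g 0)) :=
        hd.continuousAt.tendsto.mono_left nhdsWithin_le_nhds
      have hbound : Tendsto (fun μ : ℝ => -μ / 2) (𝓝[<] 0) (𝓝 0) := by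
        have : Tendsto (fun μ : ℝ => -μ / 2) (𝓝 0) (𝓝 (-0 / 2)) :=
          (continuous_neg.div_const 2).tendsto 0
        simpa using this.mono_left nhdsWithin_le_nhds
      have hzero : Tendsto g (𝓝[<] 0) (𝓝 0) := by
        refine tendsto_of_tendsto_of_tendsto_of_le_of_le' tendsto_const_nhds hbound
          (Eventually.of_forall hg_nonneg) ?_
        filter_upwards [self_mem_nhdsWithin] with μ hμ
        exact pinnedEnergy_le_of_neg h1 hρ hμ
      exact tendsto_nhds_unique hleft hzero
    have hle : deriv g 0 ≤ 0 := by
      have hs' : Tendsto (slope g 0) (𝓝[<] 0) (𝓝 (deriv g 0)) :=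
        hs.mono_left (nhdsWithin_mono _ fun x hx => ne_of_lt hx)
      refine le_of_tendsto hs' ?_
      filter_upwards [self_mem_nhdsWithin] with μ hμ
      rw [slope_def_field, hg0, sub_zero, sub_zero]
      exact div_nonpos_of_nonneg_of_nonpos (hg_nonneg μ) hμ.le
    have hge : 0 ≤ deriv g 0 := by
      have hs' : Tendsto (slope g 0) (𝓝[>] 0) (𝓝 (deriv g 0)) :=
        hs.mono_left (nhdsWithin_mono _ fun x hx => ne_of_gt hx)
      refine ge_of_tendsto hs' ?_
      filter_upwards [self_mem_nhdsWithin] with μ hμ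
      rw [slope_def_field, hg0, sub_zero, sub_zero]
      exact div_nonneg (hg_nonneg μ) (le_of_lt hμ)
    exact le_antisymm hle hge
  · exact deriv_zero_of_not_differentiableAt hd

/-! ## The rendering of CJL-II Theorem 6 contradicts CJL-I Theorem 1 -/

/-- The indicator of the closed unit ball is a CJL-II potential (`v ≥ 0` radial, `(1 + |x|⁴)v`
bounded with compact support, hence in `L¹ ∩ L²`). [folklore] -/
theorem isWeightedPotential_indicator_closedBall :
    IsWeightedPotential ((Metric.closedBall (0 : Space) 1).indicator fun _ => (1 : ℝ)) := by
  set v : Space → ℝ := (Metric.closedBall (0 : Space) 1).indicator fun _ => (1 : ℝ) with hv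
  have hmeas : MeasurableSet (Metric.closedBall (0 : Space) 1) := measurableSet_closedBall
  have hv_nonneg : ∀ x, 0 ≤ v x := fun x => Set.indicator_nonneg (fun _ _ => zero_le_one) x
  have hf_meas : AEStronglyMeasurable (fun x => (1 + ‖x‖ ^ 4) * v x) volume := by
    refine (Continuous.aestronglyMeasurable (by fun_prop)).mul ?_
    exact aestronglyMeasurable_const.indicator hmeas
  have hf_supp : HasCompactSupport (fun x => (1 + ‖x‖ ^ 4) * v x) := by
    refine HasCompactSupport.intro (isCompact_closedBall (0 : Space) 1) fun x hx => ?_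
    simp [v, Set.indicator_of_notMem hx]
  have hf_bound : ∀ x, ‖(1 + ‖x‖ ^ 4) * v x‖ ≤ 2 := by
    intro x
    by_cases hx : x ∈ Metric.closedBall (0 : Space) 1
    · have hx1 : ‖x‖ ≤ 1 := mem_closedBall_zero_iff.mp hx
      have h4 : ‖x‖ ^ 4 ≤ 1 := pow_le_one₀ (norm_nonneg x) hx1
      rw [hv, Set.indicator_of_mem hx, mul_one, Real.norm_of_nonneg (by positivity)]
      linarith
    · rw [hv, Set.indicator_of_notMem hx, mul_zero, norm_zero]
      norm_num
  refine ⟨hv_nonneg, ?_, ?_, ?_⟩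
  · intro x y hxy
    have hiff : x ∈ Metric.closedBall (0 : Space) 1 ↔ y ∈ Metric.closedBall (0 : Space) 1 := by
      rw [mem_closedBall_zero_iff, mem_closedBall_zero_iff, hxy]
    by_cases hx : x ∈ Metric.closedBall (0 : Space) 1
    · rw [hv, Set.indicator_of_mem hx, Set.indicator_of_mem (hiff.mp hx)]
    · rw [hv, Set.indicator_of_notMem hx, Set.indicator_of_notMem fun hy => hx (hiff.mpr hy)]
  · exact memLp_one_iff_integrable.mp
      (hf_supp.memLp_of_bound hf_meas 2 (Eventually.of_forall hf_bound))
  · exact hf_supp.memLp_of_bound hf_meas 2 (Eventually.of_forall hf_bound)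

/-- `∫ 1_{B₁} = |B₁| > 0`. [folklore] -/
theorem integral_indicator_closedBall_pos :
    0 < ∫ x, (Metric.closedBall (0 : Space) 1).indicator (fun _ => (1 : ℝ)) x := by
  rw [integral_indicator_const (1 : ℝ) measurableSet_closedBall, smul_eq_mul, mul_one,
    measureReal_def]
  exact ENNReal.toReal_pos (Metric.measure_closedBall_pos volume (0 : Space) one_pos).ne'
    measure_closedBall_lt_top.ne

/-- Measurability transfer through the Newton-kernel convolution integrand: if
`t ↦ Y₀(t) g(x − t)` is a.e.-strongly measurable then so is `g` (divide by `Y₀ > 0` off the null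
set `{0}` and compose with the measure-preserving reflection `t ↦ x − t`). [folklore] -/
theorem aestronglyMeasurable_of_yukawa_integrand {g : Space → ℝ} (x : Space)
    (h : AEStronglyMeasurable (fun t => yukawa 0 t * g (x - t)) volume) :
    AEStronglyMeasurable g volume := by
  have h2 : AEStronglyMeasurable (fun t => (4 * Real.pi * ‖t‖) * (yukawa 0 t * g (x - t)))
      volume :=
    (Continuous.aestronglyMeasurable (by fun_prop)).mul h
  have hne : ∀ᵐ t ∂(volume : Measure Space), t ≠ 0 := by
    have h0 : ({0}ᶜ : Set Space) ∈ ae (volume : Measure Space) :=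
      compl_mem_ae_iff.mpr (measure_singleton 0)
    filter_upwards [h0] with t ht
    simpa using ht
  have h3 : (fun t => g (x - t)) =ᵐ[volume]
      fun t => (4 * Real.pi * ‖t‖) * (yukawa 0 t * g (x - t)) := by
    filter_upwards [hne] with t ht
    rw [yukawa_zero]
    have hπ : Real.pi ≠ 0 := Real.pi_ne_zero
    have ht' : ‖t‖ ≠ 0 := norm_ne_zero_iff.mpr ht
    field_simp
  have h4 : AEStronglyMeasurable (fun t => g (x - t)) volume := h2.congr h3.symm
  have h5 := h4.comp_quasiMeasurePreserving (quasiMeasurePreserving_sub_left volume x)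
  have h6 : ((fun t => g (x - t)) ∘ fun h => x - h) = g := by
    funext s
    simp only [Function.comp_apply, sub_sub_cancel]
  rw [h6] at h5
  exact h5

/-- A scattering solution `φ` of a non-negative integrable potential `v ≢ 0` has positive
scattering length: `∫ v(1 − φ) = 0` is impossible. (If `v(1 − φ)` is integrable it vanishes a.e.,
so `φ = Y₀ ∗ 0 = 0` and `v = 0` a.e.; if not, it is not a.e.-measurable, the convolution
integrands are not either, so again `φ = 0` pointwise and `v(1 − φ) = v` would be measurable.)
[cite: CarlenJauslinLieb2020, Lemma 3.1 (3.11)] -/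
theorem IsScatteringSolution.scatteringLengthOf_pos {v φ : Space → ℝ} (hφ : IsScatteringSolution v φ)
    (h0 : ∀ x, 0 ≤ v x) (h1 : Integrable v) (hpos : 0 < ∫ x, v x) :
    0 < scatteringLengthOf v φ := by
  set g : Space → ℝ := fun x => v x * (1 - φ x) with hg_def
  have hg_nonneg : ∀ x, 0 ≤ g x := fun x => mul_nonneg (h0 x) (sub_nonneg.2 (hφ.le_one x))
  have hg_le : ∀ x, g x ≤ v x := fun x => by
    have := hφ.nonneg x
    have := h0 x
    simp only [hg_def]
    nlinarith
  have ha_nonneg : 0 ≤ ∫ x, g x := integral_nonneg hg_nonneg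
  rw [scatteringLengthOf]
  refine mul_pos (by positivity) (lt_of_le_of_ne ha_nonneg fun hint0 => ?_)
  -- hint0 : 0 = ∫ g; derive φ ≡ 0
  have hφ0 : ∀ x, φ x = 0 := by
    intro x
    rw [hφ.mild x, conv_apply]
    by_cases hgm : AEStronglyMeasurable g volume
    · have hgi : Integrable g := h1.mono hgm (Eventually.of_forall fun t => by
        rw [Real.norm_of_nonneg (hg_nonneg t), Real.norm_of_nonneg (h0 t)]; exact hg_le t)
      have hg0 : g =ᵐ[volume] 0 :=
        (integral_eq_zero_iff_of_nonneg (fun t => hg_nonneg t) hgi).mp hint0.symm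
      have hg0' : (fun t => g (x - t)) =ᵐ[volume] fun t => (0 : Space → ℝ) (x - t) :=
        (quasiMeasurePreserving_sub_left volume x).ae_eq hg0
      calc ∫ t, yukawa 0 t * g (x - t) = ∫ t, (0 : ℝ) := integral_congr_ae (by
            filter_upwards [hg0'] with t ht
            rw [ht, Pi.zero_apply, mul_zero])
        _ = 0 := integral_zero _ _
    · exact integral_non_aestronglyMeasurable fun h =>
        hgm (aestronglyMeasurable_of_yukawa_integrand x h)
  have hgv : ∀ x, g x = v x := fun x => by simp [hg_def, hφ0 x]
  have : ∫ x, v x = ∫ x, g x := integral_congr_ae (Eventually.of_forall fun x => (hgv x).symm)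
  linarith

/-- **The tree's first rendering of CJL-II Theorem 6 is inconsistent with (the rendering
`CarlenJauslinLieb2020_thm1` of) CJL-I Theorem 1.** The refuted statement — CJL-II Theorem 6
("`η = ρ∫v𝔎_e u / (1 − ρ∫v𝔎_e(2u − ρu∗u))`; `η ∼ 8√(ρa₀³)/(3√π)` as `ρ → 0`") rendered with
`η = eta v ρ`, the TWO-SIDED `μ`-derivative at `0` of the least-energy selection `pinnedEnergy`, in
the window `0 < e < e⋆`, the asymptotics uniform over solution triples — is spelled out in the
type: it was the named fact `CarlenJauslinLieb2021_thm6` of the facts file, which unfolded to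
exactly this formula, until the verdict clean-up of 2026-08-15 retired it (REFUTED ⇒ retire; the
outright form is `not_CarlenJauslinLieb2021_thm6`, `LiebSimpleEquationFactsRefuted.lean`). Proof:
take `v = 1_{B₁}` (a CJL-II potential). By `eta_eq_zero` the tree's `η` vanishes, so the asymptotic
clause with `ε = ½` reads `X ≤ X/2` for `X = 8√(ρa³)/(3√π)`, i.e. `a = 0`, at every solution
triple of small density — and CJL-I Theorem 1 supplies such triples (`ρ(e) → 0` as `e → 0⁺`, a
solution at every `(ρ(e), e)`, `ρ(e) > 0` by the energy constraint), while `a > 0`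
(`IsScatteringSolution.scatteringLengthOf_pos`). The defect is the two-sided derivative in the
tree's `eta` (CJL's `η = ∂_μ e_μ|₀` can only be a right derivative: no pinned solutions for
`μ < 0`, `IsPinnedSolution.mu_nonneg`), not the printed theorem, whose corrected rendering is
recorded in the module docstring of the facts file. [cite: CarlenJauslinLieb2021, Theorem 6] -/
theorem not_CarlenJauslinLieb2021_thm6_of_thm1 (h1 : CarlenJauslinLieb2020_thm1) :
    ¬ ∀ (v : Space → ℝ), IsWeightedPotential v → 0 < ∫ x, v x →
        (∀ (ρ e : ℝ) (u : Space → ℝ), 0 < ρ → 0 < e → e < eStar v → IsSolution v ρ e u →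
          eta v ρ = etaFormula v ρ e u) ∧
        (∃ φ : Space → ℝ, IsScatteringSolution v φ ∧
          ∀ ε : ℝ, 0 < ε → ∃ ρ₀ : ℝ, 0 < ρ₀ ∧
            ∀ (ρ e : ℝ) (u : Space → ℝ), 0 < ρ → ρ < ρ₀ → 0 < e → IsSolution v ρ e u →
              |eta v ρ - 8 * Real.sqrt (ρ * scatteringLengthOf v φ ^ 3) / (3 * Real.sqrt Real.pi)|
                ≤ ε * (8 * Real.sqrt (ρ * scatteringLengthOf v φ ^ 3) /
                  (3 * Real.sqrt Real.pi))) := by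
  intro h6
  set v : Space → ℝ := (Metric.closedBall (0 : Space) 1).indicator fun _ => (1 : ℝ) with hv_def
  have hv : IsWeightedPotential v := isWeightedPotential_indicator_closedBall
  have hpos : 0 < ∫ x, v x := integral_indicator_closedBall_pos
  obtain ⟨-, φ, hφ, hε⟩ := h6 v hv hpos
  obtain ⟨ρ₀, hρ₀, hρ⟩ := hε (1 / 2) one_half_pos
  obtain ⟨ρf, -, hzero, -, hρf⟩ :=
    h1 v 2 three_halves_lt_two hv.nonneg hv.integrable_self hv.memLp_two_self hpos
  have hev : ∀ᶠ e in 𝓝[>] (0 : ℝ), ρf e < ρ₀ := hzero (Iio_mem_nhds hρ₀)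
  obtain ⟨e, he_lt, he⟩ := (hev.and self_mem_nhdsWithin).exists
  have he' : 0 < e := he
  obtain ⟨⟨u, hu, -⟩, -⟩ := hρf e he'
  have hρpos : 0 < ρf e := by
    by_contra hle
    push Not at hle
    have hE : e = ρf e / 2 * ∫ x, (1 - u x) * v x := hu.energy
    have hI : 0 ≤ ∫ x, (1 - u x) * v x :=
      integral_nonneg fun x => mul_nonneg (sub_nonneg.2 (hu.le_one x)) (hv.nonneg x)
    have : e ≤ 0 := by
      rw [hE]
      exact mul_nonpos_of_nonpos_of_nonneg (by linarith) hI
    linarith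
  have hη := hρ (ρf e) e u hρpos he_lt he' hu
  rw [eta_eq_zero hv.integrable_self hρpos, zero_sub, abs_neg] at hη
  have ha : 0 < scatteringLengthOf v φ :=
    hφ.scatteringLengthOf_pos hv.nonneg hv.integrable_self hpos
  set a := scatteringLengthOf v φ with ha_def
  have hX : 0 < 8 * Real.sqrt (ρf e * a ^ 3) / (3 * Real.sqrt Real.pi) := by
    have : 0 < Real.sqrt (ρf e * a ^ 3) := Real.sqrt_pos.mpr (by positivity)
    positivity
  rw [abs_of_pos hX] at hη
  linarith

end LiebSimpleEquation

end Literature.MathematicalPhysics.QuantumManyBody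

end
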